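import Summits.BirchSwinnertonDyer.BirchSwinnertonDyer.Theorems.ThetaPartnerAtTwoSignedKatoUpToAtTwoInvolChain
import Summits.BirchSwinnertonDyer.BirchSwinnertonDyer.Theorems.ThetaPartnerAtTwoSignedKatoUpToAtTwoKatoBoundTwist
import Summits.BirchSwinnertonDyer.BirchSwinnertonDyer.Theorems.ThetaPartnerAtTwoSignedKatoUpToAtTwoOffTwo
import Literature.NumberTheory.EllipticCurves.Kato2004.EulerSystemBoundFineSelmerTwoContragredient
import HarnessLib

/-!
# Route `ThetaPartnerAtTwo` (TP2), crux K3 `SignedKatoDivisibilityUpToAtTwo` (item stmt-BirchSwinnertonDyer-20308),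
# line `colemanrat` v5 — THE K3P(c′) CERTIFICATE IN THE TREE: K3 BY NAME from
# {PUB print-exact Kato 13.4 (2) at 2 (contragredient), PUB Gross–Zagier–Kolyvagin} and the research stub (R2^ι) ALONE

Width seat `bsd-wall-tp2-p2x-w3` g3 (cell `bsd-wall`). HONEST FRAMING: THEOREMS ONLY — no definition, no named fact, no instance, no
`sorry`; a CONDITIONAL result (three hypotheses: two published named facts and the registered research stub (R2^ι) VERBATIM); closes no
item; BSD is NOT proved by any of this.

## Why this file

The route pen's K3R2(c′) plan (bus 02:17:45Z): the habitat routes' K3 binder becomes the twin «K3P := print-exact Kato fact → GZK → K3»,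
whose research content must be EXACTLY the registered stub (R2^ι) `stub_localRobustPackageTwoInv` of `Lines/colemanrat.lean` v5. All
pieces are now in the tree: the print-exact fact `Kato2004.thm13_4_two_lengthAt_fineSelmerDualContra_le_of_isEulerSystemClassTwo`
(typer bsd-stepL-defn-ty1 g18, p599770), its conversion to the v5 spelling (K2^ι) `IwasawaInvolution.katoBoundTwoInv_of_contra` (this
seat, p598794), the kernel chain `SignedKatoOffTwo.stub_involChainTwo` (w2 g3, p599730), and «K3 ⟺ its local form off 2»
`SignedKatoOffTwo.signedKatoDivisibilityUpToAtTwo_of_offTwo` (p566943). This file composes them: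
**`signedKatoDivisibilityUpToAtTwo_of_contraFact_of_gzk_of_packageInv : K2′-fact → GZK → (R2^ι) → K3`** — the certificate that
K3P(c′)'s research content is (R2^ι) and nothing else, as a landed theorem the route edit can cite.

References: [Kato2004Asterisque, Thm. 13.4 (2) (p. 226)]; [Kobayashi2003, Thm. 6.2–6.3, (7.17)–(7.21), Thm. 7.3]; [GrossZagier1986];
[Kolyvagin1990]; [GreenbergLNM1716, §1 p. 60]; [MazurTateTeitelbaum1986Invent, §I.17].
-/

set_option autoImplicit false
-- the Theorems namespace of this sub repeats the summit name by design (D-0017 nested layout)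
set_option linter.dupNamespace false

noncomputable section

open scoped Classical MatrixGroups ModularForm NumberField

namespace Summit.BirchSwinnertonDyer.BirchSwinnertonDyer.Theorems

namespace SignedKatoOffTwo.IwasawaInvolution

open CongruenceSubgroup WeierstrassCurve Field IsDedekindDomain NumberField
  Literature.NumberTheory.GaloisRepresentations
  Literature.NumberTheory.EllipticCurves Literature.NumberTheory.EllipticCurves.ModularForms
  Literature.NumberTheory.EllipticCurves.Module Literature.NumberTheory.EllipticCurves.Rank1Residual
  Literature.NumberTheory.EllipticCurves.Kobayashi2003 Literature.NumberTheory.EllipticCurves.Kato2004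
  Literature.NumberTheory.EllipticCurves.Kato2004.EulerSystemValues Literature.NumberTheory.EllipticCurves.GreenbergSelmer
  ZpExtension Summit.BirchSwinnertonDyer.Rank1Residual.Supersingular
  Summit.BirchSwinnertonDyer.BirchSwinnertonDyer.Theses.ThetaPartnerAtTwo

/-- **K3 BY NAME from {print-exact Kato 13.4 (2) at 2, GZK} and (R2^ι).** Hypotheses: (1) the Literature named fact
`Kato2004.thm13_4_two_lengthAt_fineSelmerDualContra_le_of_isEulerSystemClassTwo` (contragredient fine dual, SAME prime — print-exact);
(2) `rank_eq_analyticRank_of_analyticRank_le_one` (Gross–Zagier–Kolyvagin); (3) the registered research stub (R2^ι)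
`stub_localRobustPackageTwoInv` VERBATIM (localised 2-robust Coleman/Poitou–Tate package at every place above `2`, `j` additive and
`IwasawaAlgebra.invol 2`-semilinear). Conclusion: the crux `SignedKatoDivisibilityUpToAtTwo`. Composition:
`signedKatoDivisibilityUpToAtTwo_of_offTwo ∘ stub_involChainTwo ∘ katoBoundTwoInv_of_contra`.
[cite: Kato2004Asterisque, Thm. 13.4 (2) (p. 226)] [cite: Kobayashi2003, Thm. 7.3 (pp. 12–13)] -/
theorem signedKatoDivisibilityUpToAtTwo_of_contraFact_of_gzk_of_packageInv
    (hK2 : Kato2004.thm13_4_two_lengthAt_fineSelmerDualContra_le_of_isEulerSystemClassTwo)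
    (hGZK : rank_eq_analyticRank_of_analyticRank_le_one)
    (hR2 : ∀ (v : HeightOneSpectrum (𝓞 ℚ)), ((2 : ℕ) : 𝓞 ℚ) ∈ v.asIdeal →
    ∀ (W : WeierstrassCurve ℚ) [W.IsElliptic] [W.IsGloballyMinimal],
      ¬ W.HasCM → W.analyticRank = 0 → GoodSS W 2 → W.frobeniusTrace 2 = 0 →
      ∀ (κ : ZpExtension ℚ 2) (γ : Field.absoluteGaloisGroup ℚ) (hκ : κ.IsCyclotomic),
        κ.IsTopGenerator γ → IsCyclotomicVariable 2 γ →
        ∀ [NeZero (W.conductorNorm ℤ)] (f : CuspForm (Gamma0 (W.conductorNorm ℤ)) 2),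
          IsNewformOf W f → ∀ (ϖ : ℚ), (ϖ : ℝ) * W.realPeriodRat = plusPeriod f →
        ∀ (Lplus Lminus : IwasawaAlgebra 2), IsPollackPair f 2 Lplus Lminus →
        ∀ (D : SignedSelmerDualData W κ γ 1) [ContinuousSMul ℤ_[2] (W.tateModule 2)]
          [Module.Free ℤ_[2] (W.tateModule 2)] [Module.Finite ℤ_[2] (W.tateModule 2)],
          Module.IsTorsion (IwasawaAlgebra 2) D.X →
          ∀ 𝔭 : PrimeSpectrum (IwasawaAlgebra 2), 𝔭.asIdeal.height = 1 →
            PowerSeries.C (2 : ℤ_[2]) ∉ 𝔭.asIdeal →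
          ∃ (I : Kato2004.IwasawaH1Data W 2 κ γ)
            (P : Type) (_ : AddCommGroup P) (_ : _root_.Module (IwasawaAlgebra 2) P)
            (ι : P →ₗ[IwasawaAlgebra 2] IwasawaAlgebra 2) (col : I.H →ₗ[IwasawaAlgebra 2] P)
            (j : P →+ D.X) (s : I.H) (m : ℕ),
            (∀ (g : IwasawaAlgebra 2) (y : P), j (g • y) = IwasawaAlgebra.invol 2 g • j y) ∧
            (∀ y, ι y = 0 → (PowerSeries.C (2 : ℤ_[2]) : IwasawaAlgebra 2) ^ m • y = 0) ∧
            (∀ x, (PowerSeries.C (2 : ℤ_[2]) : IwasawaAlgebra 2) ^ m • j (col x) = 0) ∧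
            (∀ x : D.X,
              (∀ t : signedSelmerInfty W κ 1,
                resOfLe (W.geomPrimaryTorsion 2) (inf_le_left : κ.kerSubgroup ⊓ decomp v ≤ κ.kerSubgroup)
                  (t : W.subgroupH1 2 κ.kerSubgroup) = 0 → D.toDual x t = 0) →
              ∃ y : P, j y = (PowerSeries.C (2 : ℤ_[2]) : IwasawaAlgebra 2) ^ m • x) ∧
            Kato2004.IsEulerSystemClassTwo W hκ I s ∧
            lengthAt (IwasawaAlgebra 2) (IwasawaAlgebra 2 ⧸ Ideal.span {ι (col s)}) 𝔭 ≤
              lengthAt (IwasawaAlgebra 2) (IwasawaAlgebra 2 ⧸ Ideal.span {kobayashiL 1 Lplus Lminus}) 𝔭) :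
    SignedKatoDivisibilityUpToAtTwo :=
  signedKatoDivisibilityUpToAtTwo_of_offTwo (stub_involChainTwo (katoBoundTwoInv_of_contra hK2) hGZK hR2)

end SignedKatoOffTwo.IwasawaInvolution

end Summit.BirchSwinnertonDyer.BirchSwinnertonDyer.Theorems

end
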